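import Summits.BirchSwinnertonDyer.BirchSwinnertonDyer.Theorems.GenusKolyvaginAtTwoGenusPrimitiveSupplyAtTwoPrimeHeegnerTwinSilentPrimes
import Summits.BirchSwinnertonDyer.BirchSwinnertonDyer.Theorems.GenusKolyvaginAtTwoGenusPrimitiveSupplyAtTwoTwistingPrime
import Summits.BirchSwinnertonDyer.BirchSwinnertonDyer.Theses.GenusKolyvaginAtTwo
import HarnessLib

/-!
# Route `GenusKolyvaginAtTwo`, crux `GenusPrimitiveSupplyAtTwo` (stmt-BirchSwinnertonDyer-22136):
# SUPPLY″ = «MinimalTwinSupplyDEF1» ASSEMBLED — by the sign of `Δ` and `#Sel₂(E) ∈ {1, 4}`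

Seat `bsd-line-gk2-p5` g7 (cell `bsd-f1-sign2`), SUPPLY lineage; third file of the g7 series. Summit-side THEOREM-ONLY
file (no definition, no named fact, no `sorry`), `--supports stmt-BirchSwinnertonDyer-22136`.

WHAT. The lead's verdict on the open kernel U (item 24947, g4/g5) re-types it with «DEF(W, d_K) = 1» and files a supply
`MinimalTwinSupplyDEF1` = «an admissible Heegner field K with DEF(E,K) = 1 AND a globally minimal Sel₂-minimal twin
E^{(d_K)}» (REPAIR CENSUS v1.2 §6). The four cells of the habitat (FINDING #2 of gk2-p4 g6: `dim Sel₂(E) ≤ 2`, i.e.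
`#Sel₂(E) ∈ {1, 4}` for rank `0` and `E(ℚ)[2] = 0`) are now ALL in the kernel, each modulo ONE print/typed fact by name:

| cell | supplier | mod (BY NAME) | Čebotarev / Dirichlet |
|---|---|---|---|
| `Δ < 0`, `#Sel₂ = 1` | g6 `exists_prime_heegnerField_minimalTwin_of_prop33` | `MazurRubin2010.prop33_rat` | Dirichlet (proved) |
| `Δ < 0`, `#Sel₂ = 4` | gk2-p4 g7 `GenusKolyTwistingPrime.supply_DEF1_minimalTwin_rowOne_of_cor34i` | `MazurRubin2010.cor34i_singleton_rat` | twisting prime (proved) |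
| `Δ > 0`, `#Sel₂ = 1` | g7 `supply_DEF1_posDisc` | T-A `F1Sign2.AdmissibleTwistSelmerShiftAtTwo` | silent prime (proved) |
| `Δ > 0`, `#Sel₂ = 4`, ε = +1 | g7 `supply_DEF1_posDisc_rowOne_of_not_descentSignNeg` | T-V `F1Sign2.StrictShaPropagationAtTwo` | silent prime (proved) |
| `Δ > 0`, `#Sel₂ = 4`, ε = −1 | — FALSE mod T-V (`no_minimalTwin_of_descentSignNeg`, CONSISTENCY FINDING #3) | | |

THIS FILE: `supply_DEF1_minimalTwin` — the four suppliers in ONE statement (prime Heegner field `K = ℚ(√−ℓ)` beyond any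
bound `b`, `ℓ ≡ 7 (mod 8)`, `ℓ ∤ N_W`, every K-clause of crux 22136, `2` split, DEF(W,K) = 1 in root-count currency — one root
of the `2`-division cubic mod `ℓ` on `Δ < 0`, none on `Δ > 0` — and a GLOBALLY MINIMAL twin `Wd ≅ W^{(−ℓ)}` with
`#Sel₂(Wd) = 2`), under `ρ̄_{W,2}` onto, rank `0`, `#Sel₂(W) ∈ {1,4}` and `¬ F1Sign2.DescentSignNeg W` on `{Δ > 0, #Sel₂ = 4}`;
`supply_DEF1_minimalTwin_habitat` — the same under the binders of crux 22136 (`r_an = 0` + GZK 19921 BY NAME, `ρ_{W,2^n}`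
onto). The twin's analytic rank one is NOT asserted: it is the rank-one `2`-converse (19220/24948) after `2`-parity, exactly
as in the lead's `stub_minimalTwinSupplyAtTwo_of_twoConverse` / g6's `stubA_DEF1_of_items`. BSD is not proved by any of this.

References: [MazurRubin2010] Prop. 3.3, Cor. 3.4 (i), Prop. 5.3; [Kramer1981] Prop. 6; [GrossLMS1991] §1; [Cox2013] §1.
-/

set_option linter.dupNamespace false -- tree convention: `Summit.BirchSwinnertonDyer.BirchSwinnertonDyer.Theorems` (summit = sub-problem)
set_option autoImplicit false

noncomputable section

open scoped Classical

open NumberField WeierstrassCurve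
open Literature.NumberTheory.EllipticCurves Literature.NumberTheory.QuadraticFields
open Summit.BirchSwinnertonDyer.Rank1Residual.F1Sign2
open Summit.BirchSwinnertonDyer.BirchSwinnertonDyer.Theorems.GenusKolyTwistingPrime (supply_DEF1_minimalTwin_rowOne_of_cor34i)

namespace Summit.BirchSwinnertonDyer.BirchSwinnertonDyer.Theorems.GenusKolyTwin

variable (W : WeierstrassCurve ℚ) [W.IsElliptic] [W.IsGloballyMinimal]

/-- For a prime Heegner field `K = ℚ(√−ℓ)` (`d_K = −ℓ` odd, Heegner for `N_W`) with `2` split: `ℓ ≡ 7 (mod 8)` and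
`ℓ ∤ N_W`. [cite: GrossLMS1991, §1 (p. 235)] [cite: Cox2013, §1] -/
theorem prime_heegnerField_mod_eight {K : Type} [Field K] [NumberField K] (hK : IsImaginaryQuadratic K)
    (hodd : Odd (discr K)) (hH : SatisfiesHeegnerHypothesis (W.conductorNorm ℤ) K)
    (h2K : ((Ideal.span {(2 : ℤ)}).primesOver (𝓞 K)).ncard = 2) {ℓ : ℕ} (hℓ : ℓ.Prime)
    (hd : discr K = -(ℓ : ℤ)) : ℓ % 8 = 7 ∧ ¬ ℓ ∣ W.conductorNorm ℤ := by
  obtain ⟨-, hℓN, -⟩ := prime_discr_facts W hK hodd hH hℓ hd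
  have h8 := (Quadratic.ncard_primesOver_two_eq_two_iff hK.1).mp h2K
  rw [hd] at h8
  refine ⟨?_, hℓN⟩
  omega

/-- **SUPPLY″ («MinimalTwinSupplyDEF1») on the habitat cut out by `#Sel₂(E) ∈ {1, 4}` and `ε(E) = +1 on Δ > 0 row 1`,
modulo the four print/typed facts BY NAME** — `MazurRubin2010.prop33_rat` (Δ<0, `#Sel₂ = 1`: g6),
`MazurRubin2010.cor34i_singleton_rat` (Δ<0, `#Sel₂ = 4`: gk2-p4 g7 twisting primes ∘ g6), T-A
`F1Sign2.AdmissibleTwistSelmerShiftAtTwo` (Δ>0, `#Sel₂ = 1`: g7) and T-V `F1Sign2.StrictShaPropagationAtTwo` (Δ>0,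
`#Sel₂ = 4`, `¬ DescentSignNeg`: g7); every Čebotarev / Dirichlet input is PROVED. Statement: for `W/ℚ` globally minimal
elliptic with `ρ̄_{W,2}` onto, rank `0`, `#Sel₂(W) ∈ {1, 4}`, and `¬ F1Sign2.DescentSignNeg W` whenever `Δ_W > 0` and
`#Sel₂(W) = 4`: beyond every bound `b` there is a prime `ℓ ≡ 7 (mod 8)`, `ℓ ∤ N_W`, such that `K = ℚ(√−ℓ)` carries EVERY
K-clause of crux 22136 (imaginary quadratic, `d_K = −ℓ` odd `≠ −3`, Heegner for `N_W`, the two non-square clauses) with `2`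
split, **DEF(W,K) = 1** in root-count currency (the `2`-division cubic has exactly one root mod `ℓ` if `Δ_W < 0`, none if
`Δ_W > 0`), and the twist has a GLOBALLY MINIMAL model `Wd ≅ W^{(−ℓ)}` with `#Sel₂(Wd) = 2`. The twin's analytic rank one is
NOT asserted (rank-one `2`-converse 19220 / GZK, as for stub A). On `{Δ > 0, #Sel₂ = 4, DescentSignNeg}` the conclusion is
FALSE mod T-V (`no_minimalTwin_of_descentSignNeg`). BSD is not proved by any of this.
[cite: MazurRubin2010, Prop. 3.3, Cor. 3.4 (i), Prop. 5.3] [cite: Kramer1981, Prop. 6] [cite: GrossLMS1991, §1 (p. 235)] -/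
theorem supply_DEF1_minimalTwin (h33 : MazurRubin2010.prop33_rat) (h34 : MazurRubin2010.cor34i_singleton_rat)
    (hA : AdmissibleTwistSelmerShiftAtTwo) (hV : StrictShaPropagationAtTwo)
    (hsurj : W.HasSurjectiveModNGaloisRep 2) (hr : W.mordellWeilRank = 0)
    (h14 : Nat.card (W.selmerGroup 2) = 1 ∨ Nat.card (W.selmerGroup 2) = 4)
    (hε : 0 < W.Δ → Nat.card (W.selmerGroup 2) = 4 → ¬ DescentSignNeg W) (b : ℕ) :
    ∃ ℓ : ℕ, b < ℓ ∧ ℓ.Prime ∧ ℓ % 8 = 7 ∧ ¬ ℓ ∣ W.conductorNorm ℤ ∧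
      ((W.Δ < 0 ∧ ∃! x : ZMod ℓ, 4 * x ^ 3 + ((integralModelInt W).b₂ : ZMod ℓ) * x ^ 2 +
          2 * ((integralModelInt W).b₄ : ZMod ℓ) * x + ((integralModelInt W).b₆ : ZMod ℓ) = 0) ∨
        (0 < W.Δ ∧ ∀ x : ZMod ℓ, 4 * x ^ 3 + ((integralModelInt W).b₂ : ZMod ℓ) * x ^ 2 +
          2 * ((integralModelInt W).b₄ : ZMod ℓ) * x + ((integralModelInt W).b₆ : ZMod ℓ) ≠ 0)) ∧
      ∃ (K : Type) (_ : Field K) (_ : NumberField K), IsImaginaryQuadratic K ∧ discr K = -(ℓ : ℤ) ∧ Odd (discr K) ∧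
        discr K ≠ -3 ∧ SatisfiesHeegnerHypothesis (W.conductorNorm ℤ) K ∧
        ¬ IsSquare ((discr K : ℚ) * -|W.Δ|) ∧ ¬ IsSquare ((discr K : ℚ) * (-(2 * |W.Δ|))) ∧
        ((Ideal.span {(2 : ℤ)}).primesOver (𝓞 K)).ncard = 2 ∧
        ∃ (Wd : WeierstrassCurve ℚ) (_ : Wd.IsElliptic) (_ : Wd.IsGloballyMinimal),
          (∃ C : VariableChange ℚ, C • W.quadraticTwist (discr K : ℚ) = Wd) ∧ Nat.card (Wd.selmerGroup 2) = 2 := by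
  rcases lt_or_gt_of_ne W.isUnit_Δ.ne_zero with hΔ | hΔ
  · -- `Δ < 0`: prime Heegner fields are transposition fields (DEF = 1 for free)
    rcases h14 with h1 | h4
    · obtain ⟨K, _, _, ℓ, hℓ, hb, hK, hd, hodd, hd3, hH, hsq1, hsq2, h2K, huniq, Wd, _, _, hWd, hSel⟩ :=
        exists_prime_heegnerField_minimalTwin_of_prop33 W h33 hΔ h1 b
      obtain ⟨hℓ8, hℓN⟩ := prime_heegnerField_mod_eight W hK hodd hH h2K hℓ hd
      exact ⟨ℓ, hb, hℓ, hℓ8, hℓN, Or.inl ⟨hΔ, huniq⟩, K, inferInstance, inferInstance, hK, hd, hodd, hd3, hH, hsq1, hsq2,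
        h2K, Wd, inferInstance, inferInstance, hWd, hSel⟩
    · obtain ⟨ℓ, hℓ, hb, hℓ8, hℓ2N, K, _, _, hK, hd, hodd, hd3, hH, hsq1, hsq2, h2K, huniq, Wd, _, _, hWd, hSel⟩ :=
        supply_DEF1_minimalTwin_rowOne_of_cor34i W h34 hΔ hsurj h4 b
      have hℓN : ¬ ℓ ∣ W.conductorNorm ℤ := fun h => hℓ2N (Dvd.dvd.mul_left h 2)
      exact ⟨ℓ, hb, hℓ, hℓ8, hℓN, Or.inl ⟨hΔ, huniq⟩, K, inferInstance, inferInstance, hK, hd, hodd, hd3, hH, hsq1, hsq2,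
        h2K, Wd, inferInstance, inferInstance, hWd, hSel⟩
  · -- `Δ > 0`: silent prime Heegner fields (DEF = 1), the sign `ε(W)` on row 1
    rcases h14 with h1 | h4
    · obtain ⟨ℓ, hb, hℓ, hsil, K, _, _, hK, hd, hodd, hd3, hH, hsq1, hsq2, h2K, -, Wd, _, _, hWd, hSel⟩ :=
        supply_DEF1_posDisc W hA hΔ hsurj h1 b
      obtain ⟨hℓ8, hℓN⟩ := prime_heegnerField_mod_eight W hK hodd hH h2K hℓ hd
      exact ⟨ℓ, hb, hℓ, hℓ8, hℓN, Or.inr ⟨hΔ, hsil⟩, K, inferInstance, inferInstance, hK, hd, hodd, hd3, hH, hsq1, hsq2,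
        h2K, Wd, inferInstance, inferInstance, hWd, hSel⟩
    · obtain ⟨ℓ, hb, hℓ, hsil, K, _, _, hK, hd, hodd, hd3, hH, hsq1, hsq2, h2K, -, Wd, _, _, hWd, hSel⟩ :=
        supply_DEF1_posDisc_rowOne_of_not_descentSignNeg W hV hΔ hsurj hr h4 (hε hΔ h4) b
      obtain ⟨hℓ8, hℓN⟩ := prime_heegnerField_mod_eight W hK hodd hH h2K hℓ hd
      exact ⟨ℓ, hb, hℓ, hℓ8, hℓN, Or.inr ⟨hΔ, hsil⟩, K, inferInstance, inferInstance, hK, hd, hodd, hd3, hH, hsq1, hsq2,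
        h2K, Wd, inferInstance, inferInstance, hWd, hSel⟩

/-- **The same under the binders of crux 22136** (`r_an(W) = 0` with the Gross–Zagier–Kolyvagin fact
`rank_eq_analyticRank_of_analyticRank_le_one` = item 19921 BY NAME; `ρ_{W,2^n}` onto for every `n ≥ 1`). -/
theorem supply_DEF1_minimalTwin_habitat (h33 : MazurRubin2010.prop33_rat) (h34 : MazurRubin2010.cor34i_singleton_rat)
    (hA : AdmissibleTwistSelmerShiftAtTwo) (hV : StrictShaPropagationAtTwo)
    (hGZK : rank_eq_analyticRank_of_analyticRank_le_one) (hr0 : W.analyticRank = 0)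
    (hρ : ∀ n : ℕ, 0 < n → W.HasSurjectiveModNGaloisRep ((2 : ℤ) ^ n))
    (h14 : Nat.card (W.selmerGroup 2) = 1 ∨ Nat.card (W.selmerGroup 2) = 4)
    (hε : 0 < W.Δ → Nat.card (W.selmerGroup 2) = 4 → ¬ DescentSignNeg W) (b : ℕ) :
    ∃ ℓ : ℕ, b < ℓ ∧ ℓ.Prime ∧ ℓ % 8 = 7 ∧ ¬ ℓ ∣ W.conductorNorm ℤ ∧
      ((W.Δ < 0 ∧ ∃! x : ZMod ℓ, 4 * x ^ 3 + ((integralModelInt W).b₂ : ZMod ℓ) * x ^ 2 +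
          2 * ((integralModelInt W).b₄ : ZMod ℓ) * x + ((integralModelInt W).b₆ : ZMod ℓ) = 0) ∨
        (0 < W.Δ ∧ ∀ x : ZMod ℓ, 4 * x ^ 3 + ((integralModelInt W).b₂ : ZMod ℓ) * x ^ 2 +
          2 * ((integralModelInt W).b₄ : ZMod ℓ) * x + ((integralModelInt W).b₆ : ZMod ℓ) ≠ 0)) ∧
      ∃ (K : Type) (_ : Field K) (_ : NumberField K), IsImaginaryQuadratic K ∧ discr K = -(ℓ : ℤ) ∧ Odd (discr K) ∧
        discr K ≠ -3 ∧ SatisfiesHeegnerHypothesis (W.conductorNorm ℤ) K ∧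
        ¬ IsSquare ((discr K : ℚ) * -|W.Δ|) ∧ ¬ IsSquare ((discr K : ℚ) * (-(2 * |W.Δ|))) ∧
        ((Ideal.span {(2 : ℤ)}).primesOver (𝓞 K)).ncard = 2 ∧
        ∃ (Wd : WeierstrassCurve ℚ) (_ : Wd.IsElliptic) (_ : Wd.IsGloballyMinimal),
          (∃ C : VariableChange ℚ, C • W.quadraticTwist (discr K : ℚ) = Wd) ∧ Nat.card (Wd.selmerGroup 2) = 2 := by
  have hr : W.mordellWeilRank = 0 := by rw [(hGZK W (by rw [hr0]; exact zero_le_one)).1, hr0]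
  exact supply_DEF1_minimalTwin W h33 h34 hA hV (by simpa using hρ 1 one_pos) hr h14 hε b

/-! ## §2 (APPEND 1, same seat). The ε = −1 cells in the crux's own binders: the witness field is NOT of DEF = 1 shape -/

/-- **On `{Δ > 0, #Sel₂ = 4, ε = −1}` a Heegner field carrying a Sel₂-minimal twin has a NON-silent prime** (mod T-V BY NAME):
`W/ℚ` globally minimal elliptic, `Δ_W > 0`, no rational `2`-torsion abscissa, rank `0`, `#Sel₂(W) = 4`, `F1Sign2.DescentSignNeg W`;
`K` imaginary quadratic with odd `d_K`, Heegner for `N_W`, `2` split; if some elliptic model `Wd` of `W^{(d_K)}` has `#Sel₂(Wd) = 2`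
then some prime `q ∣ d_K` has a root of the `2`-division cubic mod `q` (`dim Ẽ(𝔽_q)[2] ≥ 1`), i.e. DEF(W,K) ≥ 1 + [Δ>0] = 2, hence
`≥ 3` (DEF is odd, `…HeegnerTwinTransposition.odd_card_transpositionPrimes_iff_Δ_neg`) — the BSD-side «no certificate» shape of
the U-LEDGER. Contrapositive of `no_minimalTwin_of_descentSignNeg`. [cite: Kramer1981, Prop. 6] [cite: CremonaMazur2000, §3] -/
theorem exists_nonsilent_prime_of_minimalTwin_of_descentSignNeg (hV : StrictShaPropagationAtTwo) (hΔ : 0 < W.Δ)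
    (ht : NoRationalTwoTorsion W) (hr : W.mordellWeilRank = 0) (h4 : Nat.card (W.selmerGroup 2) = 4)
    (hε : DescentSignNeg W) {K : Type} [Field K] [NumberField K] (hK : IsImaginaryQuadratic K) (hodd : Odd (discr K))
    (hH : SatisfiesHeegnerHypothesis (W.conductorNorm ℤ) K) (h2K : ((Ideal.span {(2 : ℤ)}).primesOver (𝓞 K)).ncard = 2)
    (Wd : WeierstrassCurve ℚ) [Wd.IsElliptic] (hWd : ∃ C : VariableChange ℚ, C • W.quadraticTwist (discr K : ℚ) = Wd)
    (hSel : Nat.card (Wd.selmerGroup 2) = 2) :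
    ∃ q : ℕ, q.Prime ∧ (q : ℤ) ∣ discr K ∧ ∃ x : ZMod q,
      4 * x ^ 3 + ((integralModelInt W).b₂ : ZMod q) * x ^ 2 + 2 * ((integralModelInt W).b₄ : ZMod q) * x +
        ((integralModelInt W).b₆ : ZMod q) = 0 := by
  by_contra hno
  push Not at hno
  have hsilent : ∀ (q : ℕ) [Fact q.Prime], (q : ℤ) ∣ discr K → ∀ x : ZMod q,
      4 * x ^ 3 + ((integralModelInt W).b₂ : ZMod q) * x ^ 2 + 2 * ((integralModelInt W).b₄ : ZMod q) * x +
        ((integralModelInt W).b₆ : ZMod q) ≠ 0 := fun q _ hq x => hno q Fact.out hq x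
  have h8 := no_minimalTwin_of_descentSignNeg W hV hΔ ht hr h4 hε hK hodd hH h2K hsilent Wd hWd
  omega

/-- **CONSISTENCY FINDING #3 in the binders of crux 22136 AS TYPED** (mod T-V and the Gross–Zagier–Kolyvagin fact 19921, both BY
NAME): if `GenusPrimitiveSupplyAtTwo` holds, then at every habitat curve `W` with `Δ_W > 0`, `2 ∣ N_W`, `#Sel₂(W) = 4` and
`F1Sign2.DescentSignNeg W` the crux's own witness field `K` (which has `2` split by the Heegner hypothesis) has a NON-silent prime,
so DEF(W,K) ≥ 3 — a field at which, BSD-side (U-LEDGER (♣)/(♥), lead's (R1) chain), no level carries a certificate. Companion of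
gk2-p4 g6's `witnessField_not_defOneShape_of_prop33_of_genusPrimitiveSupplyAtTwo` (Δ<0, `#Sel₂ > 4`). BSD is not proved or
refuted by this. [cite: Kramer1981, Prop. 6] [cite: CremonaMazur2000, §3] -/
theorem witnessField_nonsilent_of_descentSignNeg_of_genusPrimitiveSupplyAtTwo
    (hP : Summit.BirchSwinnertonDyer.BirchSwinnertonDyer.Theses.GenusKolyvaginAtTwo.GenusPrimitiveSupplyAtTwo)
    (hV : StrictShaPropagationAtTwo) (hGZK : rank_eq_analyticRank_of_analyticRank_le_one)
    [NeZero (W.conductorNorm ℤ)] (hcm : ¬ W.HasCM) (hr0 : W.analyticRank = 0)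
    (hρ : ∀ n : ℕ, 0 < n → W.HasSurjectiveModNGaloisRep ((2 : ℤ) ^ n)) (hT : Odd W.tamagawaProduct)
    (hopt : ∃ Dt : ModularForms.ModularParametrizationData W (W.conductorNorm ℤ),
      (∀ z ∈ Dt.L.lattice, ∃ w ∈ ModularForms.periodLattice Dt.f, z = (Dt.c : ℂ) * w) ∧ Odd Dt.c)
    (hΔ : 0 < W.Δ) (h2N : 2 ∣ W.conductorNorm ℤ) (h4 : Nat.card (W.selmerGroup 2) = 4) (hε : DescentSignNeg W) :
    ∃ (K : Type) (_ : Field K) (_ : NumberField K), IsImaginaryQuadratic K ∧ Odd (discr K) ∧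
      SatisfiesHeegnerHypothesis (W.conductorNorm ℤ) K ∧
      (∃ (Wd : WeierstrassCurve ℚ) (_ : Wd.IsElliptic), (∃ C : VariableChange ℚ, C • W.quadraticTwist (discr K : ℚ) = Wd) ∧
        Nat.card (Wd.selmerGroup 2) = 2) ∧
      ∃ q : ℕ, q.Prime ∧ (q : ℤ) ∣ discr K ∧ ∃ x : ZMod q,
        4 * x ^ 3 + ((integralModelInt W).b₂ : ZMod q) * x ^ 2 + 2 * ((integralModelInt W).b₄ : ZMod q) * x +
          ((integralModelInt W).b₆ : ZMod q) = 0 := by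
  obtain ⟨K, _, _, hIQ, hodd, -, hHe, -, -, -, -, -, -, -, -, -, -, -, -, -, -, -, -, -, Wd, _, _, hWd, -, -, hSel⟩ :=
    hP W hcm hr0 hρ hT hopt
  have h2K : ((Ideal.span {(2 : ℤ)}).primesOver (𝓞 K)).ncard = 2 := by
    simpa using hHe 2 Nat.prime_two h2N
  have hr : W.mordellWeilRank = 0 := by rw [(hGZK W (by rw [hr0]; exact zero_le_one)).1, hr0]
  exact ⟨K, inferInstance, inferInstance, hIQ, hodd, hHe, ⟨Wd, inferInstance, hWd, hSel⟩,
    exists_nonsilent_prime_of_minimalTwin_of_descentSignNeg W hV hΔ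
      (noRationalTwoTorsion_of_hasSurjectiveModNGaloisRep W (hρ 1 one_pos)) hr h4 hε hIQ hodd hHe h2K Wd hWd hSel⟩

/-! ## §3 (APPEND 2, same seat). The ε = −1 obstruction for DEF = 1 fields with `2` INERT (`d_K ≡ 5 (mod 8)`, `2 ∤ N_W`) -/

/-- **A Heegner field with `2` inert all of whose primes are silent is `-desc`-admissible in the unramified sense** (for `W` good at
`2`): `K` imaginary quadratic, `d_K ≡ 5 (mod 8)`, Heegner for `N_W`, no root of the `2`-division cubic modulo every prime of `d_K` ⟹
`F1Sign2.DescAdmissibleUnram W d_K`. [cite: Kramer1981, Prop. 3] [cite: GrossLMS1991, §1 (p. 235)] -/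
theorem descAdmissibleUnram_discr_of_forall_silent {K : Type} [Field K] [NumberField K] (hK : IsImaginaryQuadratic K)
    (hodd : Odd (discr K)) (hH : SatisfiesHeegnerHypothesis (W.conductorNorm ℤ) K) (h5 : discr K % 8 = 5)
    (hgood2 : ∀ _h : Fact (Nat.Prime 2), W.HasGoodReductionAtPrime 2)
    (hsilent : ∀ (q : ℕ) [Fact q.Prime], (q : ℤ) ∣ discr K → ∀ x : ZMod q,
      4 * x ^ 3 + ((integralModelInt W).b₂ : ZMod q) * x ^ 2 + 2 * ((integralModelInt W).b₄ : ZMod q) * x +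
        ((integralModelInt W).b₆ : ZMod q) ≠ 0) :
    DescAdmissibleUnram W (discr K) := by
  refine ⟨IsImaginaryQuadratic.discr_neg hK, (discr_squarefree_of_odd hK hodd).1, h5, hgood2, ?_, ?_⟩
  · intro q hq hqd
    haveI := Fact.mk hq
    have hq2 : q ≠ 2 := by
      rintro rfl
      exact (Int.not_even_iff_odd.mpr hodd) (even_iff_two_dvd.mpr (by exact_mod_cast hqd))
    have hqN : ¬ q ∣ W.conductorNorm ℤ := fun h => Literature.SatisfiesHeegnerHypothesis.not_dvd_discr hK.1 hH hq h hqd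
    have hqΔ : ¬ (q : ℤ) ∣ minimalDiscriminantInt W := fun h => hqN (dvd_conductorNorm_of_dvd_minimalDiscriminantInt W hq h)
    exact ⟨fun _ => hasGoodReductionAtPrime_of_not_dvd W q hqΔ,
      (silent_iff_odd_frobeniusTrace W hq2 hqΔ).mp (hsilent q hqd)⟩
  · intro p hp hp2 hbad
    haveI := Fact.mk hp
    have hpN : p ∣ W.conductorNorm ℤ := (W.dvd_conductorNorm_iff_not_hasGoodReductionAtPrime p).mpr (hbad ⟨hp⟩)
    exact (Quadratic.ncard_primesOver_eq_two_iff_jacobiSym hK.1 hp hp2).mp (hH p hp hpN)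

/-- **FINDING #3 for DEF = 1 fields with `2` inert** (mod T-A⁵′ `F1Sign2.MixedTwistSelmerLevelAtTwo` BY NAME; no rank hypothesis
needed): on `{Δ > 0, #Sel₂ = 4, ε = −1}` with `W` good at `2`, the twin at EVERY admissible Heegner field with `d_K ≡ 5 (mod 8)` and all
primes silent ALSO has `#Sel₂ = 8` — no escape from the obstruction through the class of `d_K` mod `8` (census 79/79 for the level law).
[cite: Kramer1981, Props. 3, 6] [cite: CremonaMazur2000, §3] -/
theorem no_minimalTwin_of_descentSignNeg_twoInert (hM : MixedTwistSelmerLevelAtTwo)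
    (hΔ : 0 < W.Δ) (ht : NoRationalTwoTorsion W) (h4 : Nat.card (W.selmerGroup 2) = 4)
    (hε : DescentSignNeg W) (hgood2 : ∀ _h : Fact (Nat.Prime 2), W.HasGoodReductionAtPrime 2)
    {K : Type} [Field K] [NumberField K] (hK : IsImaginaryQuadratic K) (hodd : Odd (discr K))
    (hH : SatisfiesHeegnerHypothesis (W.conductorNorm ℤ) K) (h5 : discr K % 8 = 5)
    (hsilent : ∀ (q : ℕ) [Fact q.Prime], (q : ℤ) ∣ discr K → ∀ x : ZMod q,
      4 * x ^ 3 + ((integralModelInt W).b₂ : ZMod q) * x ^ 2 + 2 * ((integralModelInt W).b₄ : ZMod q) * x +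
        ((integralModelInt W).b₆ : ZMod q) ≠ 0)
    (Wd : WeierstrassCurve ℚ) [Wd.IsElliptic] (hWd : ∃ C : VariableChange ℚ, C • W.quadraticTwist (discr K : ℚ) = Wd) :
    Nat.card (Wd.selmerGroup 2) = 8 := by
  have hDAU := descAdmissibleUnram_discr_of_forall_silent W hK hodd hH h5 hgood2 hsilent
  obtain ⟨d₀, hd₀, h2x⟩ := hε
  rw [selmerTwoCard, h4] at h2x
  have h8 : twistSelmerTwoCard W (discr K) = 8 := by rw [← hM W hΔ ht d₀ (discr K) hd₀ hDAU, h2x]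
  rw [natCard_selmerGroup_model_eq_twistSelmerTwoCard W (NumberField.discr_ne_zero K) Wd hWd, h8]

end Summit.BirchSwinnertonDyer.BirchSwinnertonDyer.Theorems.GenusKolyTwin
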